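import Mathlib
import HarnessLib
import Summits.HubbardSuperconductivity.HubbardSuperconductivity.Theorems.KLProgrammeKLRegimeSplitEdgeFactsRungJets
import Summits.HubbardSuperconductivity.HubbardSuperconductivity.Theorems.KLProgrammeKLRegimeSplitEdgeFactsBandJetsSup
import Summits.HubbardSuperconductivity.HubbardSuperconductivity.Theorems.KLProgrammeKLRegimeSplitEdgeFactsRungSecondDiff
import Summits.HubbardSuperconductivity.HubbardSuperconductivity.Theorems.KLProgrammeKLRegimeSplitEdgeFactsCutoffSecondDiff
import Summits.HubbardSuperconductivity.HubbardSuperconductivity.Theorems.KLProgrammeKLRegimeSplitEdgeFactsBandJets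

/-!
# Route `KLProgramme` — edge facts for the pair masses ACROSS TRANSFERS, VI′: the COMPOSED JET ROWS of row 21 (`…SplitEdgeFactsRungJets`) with ABSTRACT band-jet
# constants `(v, κ)` — `‖δ_Q ĝ‖`, `‖δ²_Q ĝ‖`, `|δ_Q w_Λ|`, `|δ²_Q w_Λ|`, `‖δ²_Q(φĝ)‖` for `φ = w_Λ` and `φ = s_{n,m}`

Cell gate-hubbard-kl, seat hubbard-kl-k3c1-p1 (g22; child-1 lineage); cure of the located «(s2)-JETS-COEFFNORM-KEYING» (HOME/STATUS 2026-08-29 ≈13:45Z).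
Row 21 bakes the band jets in as `v = 4 + coeffNorm 1 K`, `κ = 4 + coeffNorm 2 K` — coefficient weights that are not n-flat for the FLOW frames
(`coeffNorm r K_n ≈ 2¹⁴·n·cr|U|` / `2²¹·4ⁿ·cr|U|`, `…VolumeLimitFlowFramesCoeffNorm`).  THIS FILE is row 21 re-proved ONCE over ABSTRACT jet constants: section
hypotheses `hjet : (∀ k Q, |e_K(k+Q) − e_K(k)| ≤ v·|p_Q|_𝕋) ∧ (∀ k Q, |e_K(k−Q) − e_K(k)| ≤ v·|p_Q|_𝕋) ∧ (∀ k Q, |δ²_Q e_K(k)| ≤ κ·|p_Q|_𝕋²)`, `hjv : 4 ≤ v`,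
`hjκ : 4 ≤ κ` (each theorem takes exactly the ones it uses), so that BOTH keyings instantiate it: the coefficient keying of row 20 (`klbj_abs_nambuXiCT_*`, `v = 4 + coeffNorm 1 K`)
and the REGIME-NATIVE `C²` keying of row 20′ (`…BandJetsSup`: `klbs_nambuXiCT_jets`, `v = 4 + 2A`, `κ = 4 + 8A`, `‖Dʲ(frameShift K)‖ ≤ A`,
`A = 2Gfr₀|U| + 2Gfr₁U² + Gfr₂·c/log 4` for every `FrameOK` frame of the KL regime).  Statements and proofs are row 21's VERBATIM with `(4 + coeffNorm 1 K) ↦ v`,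
`(4 + coeffNorm 2 K) ↦ κ` and the three atoms read from `hjet` (prefix `klrjv_`; the jet-free lemmas `klrj_abs_mul_add_le`, `klrj_abs_cutoffWeight_le_one`,
`klrj_abs_softSymbolCompl_le_one` are imported, not restated):
* §1 `klrjv_norm_propCT_sub_le(')` (`‖δ_Q ĝ‖ ≤ v·s·‖ĝ₊‖‖ĝ‖`), `klrjv_norm_propCT_secondDiff_le(_of_size)` (`‖δ²_Q ĝ‖ ≤ (κ + 2v²g)g²s²`);
* §2 `klrjv_abs_cutoffWeight_sub_le(')` (`|δ_Q w_Λ| ≤ (16/3)E v s/Λ²`), `klrjv_abs_cutoffWeight_secondDiff_le` (`≤ ((16/3)(Eκ+v²)/Λ² + (1408/9)E²v²/Λ⁴)s²`);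
* §3–§5 `klrjv_norm_weightedRung_secondDiff_le` (abstract profile), `klrjv_norm_cutoffWeightedRung_secondDiff_le` (`φ = w_Λ`),
  `klrjv_abs_softSymbolCompl_sub_le'/_secondDiff_le`, `klrjv_norm_softWeightedRung_secondDiff_le` (`φ = s_{n,m}`).
Everything is proved; no definitions; nothing asserts any slot, stub, K3 or SC. [folklore]
-/

noncomputable section

namespace Summit.HubbardSuperconductivity.HubbardSuperconductivity.Theorems.KLRegimeSplit

set_option linter.dupNamespace false -- summit = problem name (single-conjunct summit), D-0017

open Real Finset Literature.MathematicalPhysics.QuantumLattice Literature.Probability.LatticeModels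
open Literature.MathematicalPhysics.QuantumLattice.FermiRG
open Summit.HubbardSuperconductivity.HubbardSuperconductivity.Theorems.KLProgrammeLegKernels
open Summit.HubbardSuperconductivity.HubbardSuperconductivity.Theorems.TwoPointAssembly

section Composed

variable {L M : ℕ} [NeZero L] (β μ : ℝ) (K : TrigPolyC4v)
variable {v κ : ℝ}
  (hjet : (∀ k Q : TorusSite 2 L, |nambuXiCT L μ K (k + Q) - nambuXiCT L μ K k| ≤ v * klTorusNorm L Q) ∧
    (∀ k Q : TorusSite 2 L, |nambuXiCT L μ K (k - Q) - nambuXiCT L μ K k| ≤ v * klTorusNorm L Q) ∧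
      ∀ k Q : TorusSite 2 L, |nambuXiCT L μ K (k + Q) - 2 * nambuXiCT L μ K k + nambuXiCT L μ K (k - Q)| ≤ κ * klTorusNorm L Q ^ 2)
  (hjv : 4 ≤ v) (hjκ : 4 ≤ κ)
include hjet hjv hjκ

/-! ## §1 The rung `ĝ_K(ν,·)` at a step `Q`: closed forms -/

omit [NeZero L] hjv hjκ in
/-- **First difference of the rung, closed form** (abstract jets): `‖ĝ(ν,p+Q) − ĝ(ν,p)‖ ≤ v·|p_Q|_𝕋·‖ĝ(ν,p+Q)‖·‖ĝ(ν,p)‖`. [folklore] -/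
theorem klrjv_norm_propCT_sub_le (hβ : β ≠ 0) (ν : MatsubaraIdx M) (p Q : TorusSite 2 L) :
    ‖propCT L M β μ K (ν, p + Q) - propCT L M β μ K (ν, p)‖ ≤
      v * klTorusNorm L Q * (‖propCT L M β μ K (ν, p + Q)‖ * ‖propCT L M β μ K (ν, p)‖) := by
  rw [propCT_sub_propCT_eq μ K hβ ν p Q, norm_mul, norm_neg, Complex.norm_real, Real.norm_eq_abs, norm_mul]
  exact mul_le_mul_of_nonneg_right (hjet.1 p Q) (by positivity)

omit [NeZero L] hjv hjκ in
/-- **First difference of the rung, backward**: `‖ĝ(ν,p) − ĝ(ν,p−Q)‖ ≤ v·|p_Q|_𝕋·‖ĝ(ν,p)‖·‖ĝ(ν,p−Q)‖`. [folklore] -/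
theorem klrjv_norm_propCT_sub_le' (hβ : β ≠ 0) (ν : MatsubaraIdx M) (p Q : TorusSite 2 L) :
    ‖propCT L M β μ K (ν, p) - propCT L M β μ K (ν, p - Q)‖ ≤
      v * klTorusNorm L Q * (‖propCT L M β μ K (ν, p)‖ * ‖propCT L M β μ K (ν, p - Q)‖) := by
  have h := klrjv_norm_propCT_sub_le β μ K hjet hβ ν (p - Q) Q
  rwa [sub_add_cancel] at h

omit [NeZero L] hjv hjκ in
/-- **Second difference of the rung, closed form** (abstract jets):
`‖δ²_Q ĝ(ν,p)‖ ≤ κ·s²·‖ĝ₊‖‖ĝ₋‖ + 2v²·s²·‖ĝ₊‖‖ĝ‖‖ĝ₋‖`, `s = |p_Q|_𝕋`. [folklore] -/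
theorem klrjv_norm_propCT_secondDiff_le (hβ : β ≠ 0) (ν : MatsubaraIdx M) (p Q : TorusSite 2 L) :
    ‖propCT L M β μ K (ν, p + Q) - 2 * propCT L M β μ K (ν, p) + propCT L M β μ K (ν, p - Q)‖ ≤
      κ * klTorusNorm L Q ^ 2 * (‖propCT L M β μ K (ν, p + Q)‖ * ‖propCT L M β μ K (ν, p - Q)‖) +
        2 * (v * klTorusNorm L Q) ^ 2 *
          (‖propCT L M β μ K (ν, p + Q)‖ * ‖propCT L M β μ K (ν, p)‖ * ‖propCT L M β μ K (ν, p - Q)‖) := by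
  have h2 : |nambuXiCT L μ K (p + Q) - nambuXiCT L μ K p + (nambuXiCT L μ K (p - Q) - nambuXiCT L μ K p)| ≤
      κ * klTorusNorm L Q ^ 2 := by
    rw [show nambuXiCT L μ K (p + Q) - nambuXiCT L μ K p + (nambuXiCT L μ K (p - Q) - nambuXiCT L μ K p) =
      nambuXiCT L μ K (p + Q) - 2 * nambuXiCT L μ K p + nambuXiCT L μ K (p - Q) by ring]
    exact hjet.2.2 p Q
  have hp := hjet.1 p Q
  have hm := hjet.2.1 p Q
  refine (norm_propCT_secondDiff_le μ K hβ ν p Q).trans (add_le_add ?_ ?_)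
  · exact mul_le_mul_of_nonneg_right h2 (by positivity)
  · have hsq : |nambuXiCT L μ K (p + Q) - nambuXiCT L μ K p| * |nambuXiCT L μ K (p - Q) - nambuXiCT L μ K p| ≤
        (v * klTorusNorm L Q) ^ 2 := by
      rw [sq]; exact mul_le_mul hp hm (abs_nonneg _) ((abs_nonneg _).trans hp)
    exact mul_le_mul_of_nonneg_right (mul_le_mul_of_nonneg_left hsq (by norm_num)) (by positivity)

omit [NeZero L] in
/-- **Second difference of the rung under a uniform size**: `‖ĝ(ν,p′)‖ ≤ g` at `p′ = p−Q, p, p+Q` ⟹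
`‖δ²_Q ĝ(ν,p)‖ ≤ (κ + 2v²·g)·g²·|p_Q|_𝕋²`. [folklore] -/
theorem klrjv_norm_propCT_secondDiff_le_of_size (hβ : β ≠ 0) (ν : MatsubaraIdx M) (p Q : TorusSite 2 L) {g : ℝ}
    (hgp : ‖propCT L M β μ K (ν, p + Q)‖ ≤ g) (hg : ‖propCT L M β μ K (ν, p)‖ ≤ g) (hgm : ‖propCT L M β μ K (ν, p - Q)‖ ≤ g) :
    ‖propCT L M β μ K (ν, p + Q) - 2 * propCT L M β μ K (ν, p) + propCT L M β μ K (ν, p - Q)‖ ≤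
      (κ + 2 * v ^ 2 * g) * g ^ 2 * klTorusNorm L Q ^ 2 := by
  have hg0 : 0 ≤ g := (norm_nonneg _).trans hg
  have hv : 0 ≤ v := by linarith
  have hκ : 0 ≤ κ := by linarith
  have hs := EngineV8.klband_klTorusNorm_nonneg (L := L) Q
  have h1 : ‖propCT L M β μ K (ν, p + Q)‖ * ‖propCT L M β μ K (ν, p - Q)‖ ≤ g * g :=
    mul_le_mul hgp hgm (norm_nonneg _) hg0
  have h2 : ‖propCT L M β μ K (ν, p + Q)‖ * ‖propCT L M β μ K (ν, p)‖ * ‖propCT L M β μ K (ν, p - Q)‖ ≤ g * g * g :=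
    mul_le_mul (mul_le_mul hgp hg (norm_nonneg _) hg0) hgm (norm_nonneg _) (mul_nonneg hg0 hg0)
  refine (klrjv_norm_propCT_secondDiff_le β μ K hjet hβ ν p Q).trans ?_
  have e1 : κ * klTorusNorm L Q ^ 2 * (‖propCT L M β μ K (ν, p + Q)‖ * ‖propCT L M β μ K (ν, p - Q)‖) ≤
      κ * klTorusNorm L Q ^ 2 * (g * g) := mul_le_mul_of_nonneg_left h1 (by positivity)
  have e2 : 2 * (v * klTorusNorm L Q) ^ 2 *
      (‖propCT L M β μ K (ν, p + Q)‖ * ‖propCT L M β μ K (ν, p)‖ * ‖propCT L M β μ K (ν, p - Q)‖) ≤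
      2 * (v * klTorusNorm L Q) ^ 2 * (g * g * g) := mul_le_mul_of_nonneg_left h2 (by positivity)
  have hid : κ * klTorusNorm L Q ^ 2 * (g * g) + 2 * (v * klTorusNorm L Q) ^ 2 * (g * g * g) =
      (κ + 2 * v ^ 2 * g) * g ^ 2 * klTorusNorm L Q ^ 2 := by ring
  linarith

/-! ## §2 The CT cutoff weight `w^K_Λ(ν,·)` at a step `Q`, given the band size `|e_K| ≤ E` -/

omit [NeZero L] hjv hjκ in
/-- **First difference of the cutoff weight, closed form**: `|e_K(p)|, |e_K(p+Q)| ≤ E` ⟹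
`|w_Λ(ν,p+Q) − w_Λ(ν,p)| ≤ (8/3)·(v·|p_Q|_𝕋·2E)/Λ²` (`= (16/3)E·v·s/Λ²`). [folklore] -/
theorem klrjv_abs_cutoffWeight_sub_le (Λ : ℝ) (ν : MatsubaraIdx M) (p Q : TorusSite 2 L) {E : ℝ} (hEp : |nambuXiCT L μ K (p + Q)| ≤ E)
    (hE : |nambuXiCT L μ K p| ≤ E) :
    |hubbardCutoffWeightCT L M β μ K Λ (ν, p + Q) - hubbardCutoffWeightCT L M β μ K Λ (ν, p)| ≤
      8 / 3 * (v * klTorusNorm L Q * (2 * E) / Λ ^ 2) := by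
  refine (abs_hubbardCutoffWeightCT_sub_le β μ K Λ ν p Q).trans (mul_le_mul_of_nonneg_left ?_ (by norm_num))
  rw [abs_div, abs_of_nonneg (sq_nonneg Λ)]
  exact div_le_div_of_nonneg_right (klrj_abs_mul_add_le (hjet.1 p Q) hE hEp) (sq_nonneg _)

omit [NeZero L] hjv hjκ in
/-- **First difference of the cutoff weight, backward**: `|e_K(p)|, |e_K(p−Q)| ≤ E` ⟹ `|w_Λ(ν,p) − w_Λ(ν,p−Q)| ≤ (8/3)·(v·|p_Q|_𝕋·2E)/Λ²`.
[folklore] -/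
theorem klrjv_abs_cutoffWeight_sub_le' (Λ : ℝ) (ν : MatsubaraIdx M) (p Q : TorusSite 2 L) {E : ℝ} (hE : |nambuXiCT L μ K p| ≤ E)
    (hEm : |nambuXiCT L μ K (p - Q)| ≤ E) :
    |hubbardCutoffWeightCT L M β μ K Λ (ν, p) - hubbardCutoffWeightCT L M β μ K Λ (ν, p - Q)| ≤
      8 / 3 * (v * klTorusNorm L Q * (2 * E) / Λ ^ 2) := by
  have h := klrjv_abs_cutoffWeight_sub_le β μ K hjet Λ ν (p - Q) Q (E := E) (by rwa [sub_add_cancel]) hEm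
  rwa [sub_add_cancel] at h

omit [NeZero L] hjκ in
/-- **Second difference of the cutoff weight, closed form**: `|e_K| ≤ E` at `p−Q, p, p+Q` ⟹
`|δ²_Q w_Λ(ν,p)| ≤ ((16/3)·(E·κ + v²)/Λ² + (1408/9)·E²·v²/Λ⁴)·|p_Q|_𝕋²`. [folklore] -/
theorem klrjv_abs_cutoffWeight_secondDiff_le (Λ : ℝ) (ν : MatsubaraIdx M) (p Q : TorusSite 2 L) {E : ℝ} (hEp : |nambuXiCT L μ K (p + Q)| ≤ E)
    (hE : |nambuXiCT L μ K p| ≤ E) (hEm : |nambuXiCT L μ K (p - Q)| ≤ E) :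
    |hubbardCutoffWeightCT L M β μ K Λ (ν, p + Q) - 2 * hubbardCutoffWeightCT L M β μ K Λ (ν, p) + hubbardCutoffWeightCT L M β μ K Λ (ν, p - Q)| ≤
      (16 / 3 * (E * κ + v ^ 2) / Λ ^ 2 + 1408 / 9 * E ^ 2 * v ^ 2 / Λ ^ 4) *
        klTorusNorm L Q ^ 2 := by
  set s := klTorusNorm L Q with hs
  set e₂ := nambuXiCT L μ K (p + Q)
  set e₁ := nambuXiCT L μ K p
  set e₀ := nambuXiCT L μ K (p - Q)
  have hE0 : 0 ≤ E := (abs_nonneg _).trans hE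
  have hs0 : 0 ≤ s := EngineV8.klband_klTorusNorm_nonneg (L := L) Q
  have hv0 : 0 ≤ v := by linarith
  have hp : |e₂ - e₁| ≤ v * s := hjet.1 p Q
  have hm : |e₀ - e₁| ≤ v * s := hjet.2.1 p Q
  have h2 : |e₂ - 2 * e₁ + e₀| ≤ κ * s ^ 2 := hjet.2.2 p Q
  -- the first-order pieces `δ^±u = δ^±e (e^± + e)/Λ²`
  have hup : |(e₂ - e₁) * (e₂ + e₁) / Λ ^ 2| ≤ v * s * (2 * E) / Λ ^ 2 := by
    rw [abs_div, abs_of_nonneg (sq_nonneg Λ)]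
    exact div_le_div_of_nonneg_right (klrj_abs_mul_add_le hp hE hEp) (sq_nonneg _)
  have hum : |(e₀ - e₁) * (e₀ + e₁) / Λ ^ 2| ≤ v * s * (2 * E) / Λ ^ 2 := by
    rw [abs_div, abs_of_nonneg (sq_nonneg Λ)]
    exact div_le_div_of_nonneg_right (klrj_abs_mul_add_le hm hE hEm) (sq_nonneg _)
  -- the second-order piece `δ²u = (2e δ²e + (δ⁺e)² + (δ⁻e)²)/Λ²`
  have hnum : |2 * e₁ * (e₂ - 2 * e₁ + e₀) + (e₂ - e₁) ^ 2 + (e₀ - e₁) ^ 2| ≤ 2 * E * (κ * s ^ 2) + 2 * (v * s) ^ 2 := by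
    have t1 : |2 * e₁ * (e₂ - 2 * e₁ + e₀)| ≤ 2 * E * (κ * s ^ 2) := by
      rw [abs_mul, abs_mul, abs_two]
      exact mul_le_mul (mul_le_mul_of_nonneg_left hE (by norm_num)) h2 (abs_nonneg _) (by positivity)
    have t2 : |(e₂ - e₁) ^ 2| ≤ (v * s) ^ 2 := by rw [abs_pow]; exact pow_le_pow_left₀ (abs_nonneg _) hp 2
    have t3 : |(e₀ - e₁) ^ 2| ≤ (v * s) ^ 2 := by rw [abs_pow]; exact pow_le_pow_left₀ (abs_nonneg _) hm 2
    have := abs_add_three (2 * e₁ * (e₂ - 2 * e₁ + e₀)) ((e₂ - e₁) ^ 2) ((e₀ - e₁) ^ 2)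
    linarith
  have hu2 : |(2 * e₁ * (e₂ - 2 * e₁ + e₀) + (e₂ - e₁) ^ 2 + (e₀ - e₁) ^ 2) / Λ ^ 2| ≤ (2 * E * (κ * s ^ 2) + 2 * (v * s) ^ 2) / Λ ^ 2 := by
    rw [abs_div, abs_of_nonneg (sq_nonneg Λ)]
    exact div_le_div_of_nonneg_right hnum (sq_nonneg _)
  have hsqp : ((e₂ - e₁) * (e₂ + e₁) / Λ ^ 2) ^ 2 ≤ (v * s * (2 * E) / Λ ^ 2) ^ 2 := by
    rw [← sq_abs]; exact pow_le_pow_left₀ (abs_nonneg _) hup 2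
  have hsqm : ((e₀ - e₁) * (e₀ + e₁) / Λ ^ 2) ^ 2 ≤ (v * s * (2 * E) / Λ ^ 2) ^ 2 := by
    rw [← sq_abs]; exact pow_le_pow_left₀ (abs_nonneg _) hum 2
  have hmain := abs_hubbardCutoffWeightCT_secondDiff_le β μ K Λ ν p Q
  have hid : 8 / 3 * ((2 * E * (κ * s ^ 2) + 2 * (v * s) ^ 2) / Λ ^ 2) + 176 / 9 * ((v * s * (2 * E) / Λ ^ 2) ^ 2 + (v * s * (2 * E) / Λ ^ 2) ^ 2) =
      (16 / 3 * (E * κ + v ^ 2) / Λ ^ 2 + 1408 / 9 * E ^ 2 * v ^ 2 / Λ ^ 4) * s ^ 2 := by ring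
  rw [← hid]
  refine hmain.trans (add_le_add ?_ ?_)
  · exact mul_le_mul_of_nonneg_left hu2 (by norm_num)
  · exact mul_le_mul_of_nonneg_left (add_le_add hsqp hsqm) (by norm_num)

/-! ## §3 A weighted rung `φ·ĝ_K` with abstract profile sizes -/

omit [NeZero L] in
/-- **Second difference of a weighted rung, closed form**: with rung sizes `‖ĝ(ν,p′)‖ ≤ g` (`p′ = p−Q, p, p+Q`) and profile sizes `|φ(ν,p−Q)| ≤ Φ₀`,
`|φ(ν,p) − φ(ν,p−Q)| ≤ Φ₁`, `|δ²_Qφ(ν,p)| ≤ Φ₂`: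
`‖δ²_Q(φĝ)(ν,p)‖ ≤ Φ₂·g + 2·Φ₁·(v·s)·g² + Φ₀·(κ + 2v²·g)·g²·s²`, `s = |p_Q|_𝕋`. [folklore] -/
theorem klrjv_norm_weightedRung_secondDiff_le (hβ : β ≠ 0) (φ : FreqMomentum L M → ℝ) (ν : MatsubaraIdx M) (p Q : TorusSite 2 L)
    {g Φ₀ Φ₁ Φ₂ : ℝ} (hgp : ‖propCT L M β μ K (ν, p + Q)‖ ≤ g) (hg : ‖propCT L M β μ K (ν, p)‖ ≤ g) (hgm : ‖propCT L M β μ K (ν, p - Q)‖ ≤ g)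
    (h0 : |φ (ν, p - Q)| ≤ Φ₀) (h1 : |φ (ν, p) - φ (ν, p - Q)| ≤ Φ₁) (h2 : |φ (ν, p + Q) - 2 * φ (ν, p) + φ (ν, p - Q)| ≤ Φ₂) :
    ‖(φ (ν, p + Q) : ℂ) * propCT L M β μ K (ν, p + Q) - 2 * ((φ (ν, p) : ℂ) * propCT L M β μ K (ν, p)) +
        (φ (ν, p - Q) : ℂ) * propCT L M β μ K (ν, p - Q)‖ ≤
      Φ₂ * g + 2 * (Φ₁ * (v * klTorusNorm L Q * g ^ 2)) +
        Φ₀ * ((κ + 2 * v ^ 2 * g) * g ^ 2 * klTorusNorm L Q ^ 2) := by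
  have hg0 : 0 ≤ g := (norm_nonneg _).trans hg
  have hΦ₀ : 0 ≤ Φ₀ := (abs_nonneg _).trans h0
  have hΦ₁ : 0 ≤ Φ₁ := (abs_nonneg _).trans h1
  have hΦ₂ : 0 ≤ Φ₂ := (abs_nonneg _).trans h2
  have hvs : 0 ≤ v * klTorusNorm L Q :=
    mul_nonneg (by linarith) (EngineV8.klband_klTorusNorm_nonneg (L := L) Q)
  have hd := hjet.1 p Q
  have hdd := klrjv_norm_propCT_secondDiff_le_of_size β μ K hjet hjv hjκ hβ ν p Q hgp hg hgm
  refine (norm_weightedRung_secondDiff_le μ K hβ φ ν p Q).trans (add_le_add_three ?_ ?_ ?_)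
  · exact mul_le_mul h2 hgp (norm_nonneg _) hΦ₂
  · refine mul_le_mul_of_nonneg_left ?_ (by norm_num)
    have hgg : ‖propCT L M β μ K (ν, p + Q)‖ * ‖propCT L M β μ K (ν, p)‖ ≤ g ^ 2 := by
      rw [sq]; exact mul_le_mul hgp hg (norm_nonneg _) hg0
    exact mul_le_mul h1 (mul_le_mul hd hgg (by positivity) hvs) (by positivity) hΦ₁
  · exact mul_le_mul h0 hdd (norm_nonneg _) hΦ₀

/-! ## §4 The hard-shell member `φ = w^K_Λ`: one closed form in `E, Λ, g` and the frame weights -/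

omit [NeZero L] in
/-- **Second difference of the hard-shell weighted rung `w_Λ·ĝ_K`, closed form**: rung sizes `‖ĝ(ν,p′)‖ ≤ g` and band sizes `|e_K(p′)| ≤ E` at
`p′ = p−Q, p, p+Q` ⟹ `‖δ²_Q(w_Λĝ)(ν,p)‖ ≤ C·|p_Q|_𝕋²`,
`C = ((16/3)(Eκ + v²)/Λ² + (1408/9)E²v²/Λ⁴)·g + 2·((8/3)(v·2E/Λ²))·v·g² + (κ + 2v²g)·g²` (`v = v`, `κ = κ`). [folklore] -/
theorem klrjv_norm_cutoffWeightedRung_secondDiff_le (hβ : β ≠ 0) (Λ : ℝ) (ν : MatsubaraIdx M) (p Q : TorusSite 2 L) {g E : ℝ}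
    (hgp : ‖propCT L M β μ K (ν, p + Q)‖ ≤ g) (hg : ‖propCT L M β μ K (ν, p)‖ ≤ g) (hgm : ‖propCT L M β μ K (ν, p - Q)‖ ≤ g)
    (hEp : |nambuXiCT L μ K (p + Q)| ≤ E) (hE : |nambuXiCT L μ K p| ≤ E) (hEm : |nambuXiCT L μ K (p - Q)| ≤ E) :
    ‖(hubbardCutoffWeightCT L M β μ K Λ (ν, p + Q) : ℂ) * propCT L M β μ K (ν, p + Q) -
          2 * ((hubbardCutoffWeightCT L M β μ K Λ (ν, p) : ℂ) * propCT L M β μ K (ν, p)) +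
        (hubbardCutoffWeightCT L M β μ K Λ (ν, p - Q) : ℂ) * propCT L M β μ K (ν, p - Q)‖ ≤
      ((16 / 3 * (E * κ + v ^ 2) / Λ ^ 2 + 1408 / 9 * E ^ 2 * v ^ 2 / Λ ^ 4) * g +
            2 * (8 / 3 * (v * (2 * E) / Λ ^ 2)) * v * g ^ 2 +
          (κ + 2 * v ^ 2 * g) * g ^ 2) *
        klTorusNorm L Q ^ 2 := by
  have h := klrjv_norm_weightedRung_secondDiff_le β μ K hjet hjv hjκ hβ (hubbardCutoffWeightCT L M β μ K Λ) ν p Q hgp hg hgm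
    (klrj_abs_cutoffWeight_le_one β μ K Λ (ν, p - Q)) (klrjv_abs_cutoffWeight_sub_le' β μ K hjet Λ ν p Q hE hEm)
    (klrjv_abs_cutoffWeight_secondDiff_le β μ K hjet hjv Λ ν p Q hEp hE hEm)
  refine h.trans (le_of_eq ?_)
  ring

/-! ## §5 The complementary member `φ = softSymbolCompl … n m = w_{Λ_m} − w_{Λ_n}`: the same, summed over the two scales -/

omit [NeZero L] hjv hjκ in
/-- **First difference of the complementary member, backward**: `|e_K(p)|, |e_K(p−Q)| ≤ E` ⟹
`|φ(ν,p) − φ(ν,p−Q)| ≤ (8/3)(v·s·2E)/Λ_m² + (8/3)(v·s·2E)/Λ_n²` (`φ = w_{Λ_m} − w_{Λ_n}`). [folklore] -/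
theorem klrjv_abs_softSymbolCompl_sub_le' [NeZero M] (n m : ℕ) (ν : MatsubaraIdx M) (p Q : TorusSite 2 L) {E : ℝ} (hE : |nambuXiCT L μ K p| ≤ E)
    (hEm : |nambuXiCT L μ K (p - Q)| ≤ E) :
    |softSymbolCompl L M β μ K n m (ν, p) - softSymbolCompl L M β μ K n m (ν, p - Q)| ≤
      8 / 3 * (v * klTorusNorm L Q * (2 * E) / klScale klE0 m ^ 2) +
        8 / 3 * (v * klTorusNorm L Q * (2 * E) / klScale klE0 n ^ 2) := by
  have hm := klrjv_abs_cutoffWeight_sub_le' β μ K hjet (klScale klE0 m) ν p Q hE hEm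
  have hn := klrjv_abs_cutoffWeight_sub_le' β μ K hjet (klScale klE0 n) ν p Q hE hEm
  simp only [softSymbolCompl]
  rw [show hubbardCutoffWeightCT L M β μ K (klScale klE0 m) (ν, p) - hubbardCutoffWeightCT L M β μ K (klScale klE0 n) (ν, p) -
      (hubbardCutoffWeightCT L M β μ K (klScale klE0 m) (ν, p - Q) - hubbardCutoffWeightCT L M β μ K (klScale klE0 n) (ν, p - Q)) =
      (hubbardCutoffWeightCT L M β μ K (klScale klE0 m) (ν, p) - hubbardCutoffWeightCT L M β μ K (klScale klE0 m) (ν, p - Q)) -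
        (hubbardCutoffWeightCT L M β μ K (klScale klE0 n) (ν, p) - hubbardCutoffWeightCT L M β μ K (klScale klE0 n) (ν, p - Q)) by ring]
  exact (abs_sub _ _).trans (add_le_add hm hn)

omit hjκ in
/-- **Second difference of the complementary member**: `|e_K| ≤ E` at `p−Q, p, p+Q` ⟹ `|δ²_Qφ(ν,p)| ≤ (C₂(Λ_m) + C₂(Λ_n))·s²`,
`C₂(Λ) = (16/3)(Eκ + v²)/Λ² + (1408/9)E²v²/Λ⁴` (`φ = w_{Λ_m} − w_{Λ_n}`). [folklore] -/
theorem klrjv_abs_softSymbolCompl_secondDiff_le [NeZero M] (n m : ℕ) (ν : MatsubaraIdx M) (p Q : TorusSite 2 L) {E : ℝ}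
    (hEp : |nambuXiCT L μ K (p + Q)| ≤ E) (hE : |nambuXiCT L μ K p| ≤ E) (hEm : |nambuXiCT L μ K (p - Q)| ≤ E) :
    |softSymbolCompl L M β μ K n m (ν, p + Q) - 2 * softSymbolCompl L M β μ K n m (ν, p) + softSymbolCompl L M β μ K n m (ν, p - Q)| ≤
      ((16 / 3 * (E * κ + v ^ 2) / klScale klE0 m ^ 2 +
            1408 / 9 * E ^ 2 * v ^ 2 / klScale klE0 m ^ 4) +
          (16 / 3 * (E * κ + v ^ 2) / klScale klE0 n ^ 2 +
            1408 / 9 * E ^ 2 * v ^ 2 / klScale klE0 n ^ 4)) * klTorusNorm L Q ^ 2 := by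
  have hm := klrjv_abs_cutoffWeight_secondDiff_le β μ K hjet hjv (klScale klE0 m) ν p Q hEp hE hEm
  have hn := klrjv_abs_cutoffWeight_secondDiff_le β μ K hjet hjv (klScale klE0 n) ν p Q hEp hE hEm
  refine (abs_softSymbolCompl_secondDiff_le β μ K n m ν p Q).trans ?_
  rw [add_mul]
  exact add_le_add hm hn

/-- **Second difference of the complementary weighted rung `(w_{Λ_m} − w_{Λ_n})·ĝ_K`, closed form**: rung sizes `‖ĝ(ν,p′)‖ ≤ g` and band sizes
`|e_K(p′)| ≤ E` at `p′ = p−Q, p, p+Q` ⟹ `‖δ²_Q(φĝ)(ν,p)‖ ≤ (C(Λ_m-part) + C(Λ_n-part) + (κ + 2v²g)g²)·|p_Q|_𝕋²` — the §4 shape with the `Λ`-dependent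
terms summed over the two scales. [folklore] -/
theorem klrjv_norm_softWeightedRung_secondDiff_le [NeZero M] (hβ : β ≠ 0) (n m : ℕ) (ν : MatsubaraIdx M) (p Q : TorusSite 2 L) {g E : ℝ}
    (hgp : ‖propCT L M β μ K (ν, p + Q)‖ ≤ g) (hg : ‖propCT L M β μ K (ν, p)‖ ≤ g) (hgm : ‖propCT L M β μ K (ν, p - Q)‖ ≤ g)
    (hEp : |nambuXiCT L μ K (p + Q)| ≤ E) (hE : |nambuXiCT L μ K p| ≤ E) (hEm : |nambuXiCT L μ K (p - Q)| ≤ E) :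
    ‖(softSymbolCompl L M β μ K n m (ν, p + Q) : ℂ) * propCT L M β μ K (ν, p + Q) -
          2 * ((softSymbolCompl L M β μ K n m (ν, p) : ℂ) * propCT L M β μ K (ν, p)) +
        (softSymbolCompl L M β μ K n m (ν, p - Q) : ℂ) * propCT L M β μ K (ν, p - Q)‖ ≤
      (((16 / 3 * (E * κ + v ^ 2) / klScale klE0 m ^ 2 +
              1408 / 9 * E ^ 2 * v ^ 2 / klScale klE0 m ^ 4) +
            (16 / 3 * (E * κ + v ^ 2) / klScale klE0 n ^ 2 +
              1408 / 9 * E ^ 2 * v ^ 2 / klScale klE0 n ^ 4)) * g +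
          2 * (8 / 3 * (v * (2 * E) / klScale klE0 m ^ 2) + 8 / 3 * (v * (2 * E) / klScale klE0 n ^ 2)) *
            v * g ^ 2 +
          (κ + 2 * v ^ 2 * g) * g ^ 2) * klTorusNorm L Q ^ 2 := by
  have h := klrjv_norm_weightedRung_secondDiff_le β μ K hjet hjv hjκ hβ (softSymbolCompl L M β μ K n m) ν p Q hgp hg hgm
    (klrj_abs_softSymbolCompl_le_one β μ K n m (ν, p - Q)) (klrjv_abs_softSymbolCompl_sub_le' β μ K hjet n m ν p Q hE hEm)
    (klrjv_abs_softSymbolCompl_secondDiff_le β μ K hjet hjv n m ν p Q hEp hE hEm)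
  refine h.trans (le_of_eq ?_)
  ring

end Composed

end Summit.HubbardSuperconductivity.HubbardSuperconductivity.Theorems.KLRegimeSplit

end

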